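import Mathlib
import Literature.Analysis.PDE.WeakBVStabilityProofs
import HarnessLib

/-!
# Rankine–Hugoniot discontinuities and the shock curves of the isentropic Euler system

Topic `Literature/Analysis/PDE`. Vocabulary and first properties for **Assumption 1.1 (f)–(k)** of
[ChenKrupaVasseur2022] (shock curves `S¹_{u_L}`, `S²_{u_R}`, entropic Rankine–Hugoniot
discontinuities, Lax/Liu admissibility, "the shock strengthens with `s`") in the case of the
isentropic Euler system of §1 / Lemma 4.5 (`isentropicEulerFlux γ`, `p(ρ) = ρ^γ`), for which the
paper cites Leger–Vasseur [LegerVasseur2011, §6.1]; there the shock curves are explicit, the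
parameter `s > 0` being the density jump across the shock:

* `IsRankineHugoniot f u_L u_R σ` — the Rankine–Hugoniot condition `f(u_R) - f(u_L) = σ(u_R - u_L)`
  for a general `n × n` flux (Leger–Vasseur (4): `A(U_R) - A(U_L) = σ(U_R - U_L)`);
* `IsEntropicRankineHugoniot f η q u_L u_R σ` — additionally `q(u_R) - q(u_L) ≤ σ(η(u_R) - η(u_L))`
  ("entropic Rankine–Hugoniot discontinuity", Leger–Vasseur §2.1, Chen–Krupa–Vasseur
  Assumption 1.1 (g)–(j));
* `oneShockCurve γ U s`, `oneShockSpeed γ U s` — the right state and the speed of the 1-shock with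
  LEFT state `U = (ρ, ρu)` and density jump `s`: `S_U(s) = (ρ+s, (ρ+s)(u - √((P(ρ+s)-P(ρ))s/(ρ(ρ+s)))))`,
  `σ_U(s) = u - √(((ρ+s)/ρ)(P(ρ+s)-P(ρ))/s)` (Leger–Vasseur §6.1, case (H1), minus signs; the printed
  momentum component `ρu - ρ√(…)` is corrected to `(ρ+s)(u - √(…))`, the value forced by the
  Rankine–Hugoniot relation (6.2) `(u_L-u_R)² = (P_R-P_L)(ρ_R-ρ_L)/(ρ_Rρ_L)` — see
  `isRankineHugoniot_oneShockCurve`, which the kernel checks);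
* `twoShockCurve γ U s`, `twoShockSpeed γ U s` — the LEFT state and the speed of the 2-shock with
  RIGHT state `U` and density jump `s` (case (H'1), plus signs).

Proved here: `S_U(0) = U`; for `ρ > 0`, `s > 0` the pairs `(U, S¹_U(s))`, `(S²_U(s), U)` satisfy the
Rankine–Hugoniot condition with the displayed speeds; the 1-shock is compressive (`ρ_R > ρ_L`,
`u_R < u_L`) and so is the 2-shock (`ρ_L > ρ_R`, `u_L > u_R`); and, for `γ ≥ 1`, the **Lax
inequalities** `λ₁(S¹_U(s)) < σ¹_U(s) < λ₁(U)` and `λ₂(U) < σ²_U(s) < λ₂(S²_U(s))` (from the convexity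
of `P`: `P′(ρ) ≤ (P(ρ+s)-P(ρ))/s ≤ P′(ρ+s)`), i.e. Chen–Krupa–Vasseur Assumption 1.1 (g), (i) along
the curves.

Deliberately NOT here (next steps of Assumption 1.1 (f)–(k)): the Liu monotonicity `dσ¹/ds < 0` and the
strengthening `d/ds η(U | S¹_U(s)) > 0` (Leger–Vasseur §6.1), the characterisation of entropic
Rankine–Hugoniot discontinuities of the `γ`-law as the compressive ones (Lax's dissipation
formula, Leger–Vasseur §3 Lemma 3), and the reparametrisation by `s = |u_L - S¹_{u_L}(s)|` used in
[ChenKrupaVasseur2022, Assumption 1.1 (f)].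

## References

* N. Leger, A. Vasseur, *Relative entropy and the stability of shocks and contact discontinuities
  for systems of conservation laws with non-BV perturbations*, Arch. Ration. Mech. Anal. 201 (2011)
  271–302; arXiv:1008.3113: §2.1 (entropic Rankine–Hugoniot discontinuity, (4)), §2.2 (H1)–(H3),
  §6.1 (isentropic Euler: (6.1)–(6.2), `S_U`, `σ_U`) [LegerVasseur2011].
* G. Chen, S. G. Krupa, A. F. Vasseur, Arch. Ration. Mech. Anal. 246 (2022) 299–332;
  arXiv:2010.04761, Assumption 1.1 (f)–(k), Lemma 4.5 [ChenKrupaVasseur2022].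
-/

noncomputable section

open Set

namespace Literature.Analysis.PDE

variable {n : ℕ}

/-! ## Rankine–Hugoniot discontinuities for an `n × n` flux -/

/-- **Rankine–Hugoniot condition** for a discontinuity `(u_L, u_R)` travelling with speed `σ` in
the system `uₜ + f(u)ₓ = 0`: `f(u_R) - f(u_L) = σ (u_R - u_L)`.
[cite: LegerVasseur2011, §2.1 (4)] -/
def IsRankineHugoniot (f : (Fin n → ℝ) → (Fin n → ℝ)) (uL uR : Fin n → ℝ) (σ : ℝ) : Prop :=
  f uR - f uL = σ • (uR - uL)

/-- **Entropic Rankine–Hugoniot discontinuity** for the entropy pair `(η, q)`: the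
Rankine–Hugoniot condition together with the jump entropy inequality
`q(u_R) - q(u_L) ≤ σ (η(u_R) - η(u_L))` (equivalently, the two-state function `u_L 𝟙_{x<σt} +
u_R 𝟙_{x>σt}` is a weak solution satisfying `η(u)ₜ + q(u)ₓ ≤ 0`).
[cite: LegerVasseur2011, §2.1 (4)] -/
def IsEntropicRankineHugoniot (f : (Fin n → ℝ) → (Fin n → ℝ)) (η q : (Fin n → ℝ) → ℝ)
    (uL uR : Fin n → ℝ) (σ : ℝ) : Prop :=
  IsRankineHugoniot f uL uR σ ∧ q uR - q uL ≤ σ * (η uR - η uL)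

/-- The Rankine–Hugoniot condition componentwise. [folklore] -/
theorem isRankineHugoniot_iff (f : (Fin n → ℝ) → (Fin n → ℝ)) (uL uR : Fin n → ℝ) (σ : ℝ) :
    IsRankineHugoniot f uL uR σ ↔ ∀ i, f uR i - f uL i = σ * (uR i - uL i) := by
  simp only [IsRankineHugoniot, funext_iff, Pi.sub_apply, Pi.smul_apply, smul_eq_mul]

/-- The trivial discontinuity `u_L = u_R` is Rankine–Hugoniot for every speed. [folklore] -/
theorem isRankineHugoniot_self (f : (Fin n → ℝ) → (Fin n → ℝ)) (u : Fin n → ℝ) (σ : ℝ) :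
    IsRankineHugoniot f u u σ := by
  simp [IsRankineHugoniot]

/-! ## The shock curves of the isentropic Euler system (Leger–Vasseur §6.1, `P(ρ) = ρ^γ`) -/

variable {γ : ℝ}

/-- Right state of the **1-shock** with left state `U = (ρ, ρu)` and density jump `s`:
`S¹_U(s) = (ρ + s, (ρ + s)(u - √((P(ρ+s) - P(ρ)) s / (ρ(ρ+s)))))`, `P(ρ) = ρ^γ`
(Leger–Vasseur §6.1, (H1) case, with the velocity jump given by (6.2)).
[cite: LegerVasseur2011, §6.1] -/
def oneShockCurve (γ : ℝ) (U : Fin 2 → ℝ) (s : ℝ) : Fin 2 → ℝ :=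
  ![U 0 + s, (U 0 + s) * (U 1 / U 0
    - Real.sqrt (((U 0 + s) ^ γ - (U 0) ^ γ) * s / (U 0 * (U 0 + s))))]

/-- Speed of the 1-shock with left state `U = (ρ, ρu)` and density jump `s`:
`σ¹_U(s) = u - √(((ρ+s)/ρ) (P(ρ+s) - P(ρ))/s)`. [cite: LegerVasseur2011, §6.1] -/
def oneShockSpeed (γ : ℝ) (U : Fin 2 → ℝ) (s : ℝ) : ℝ :=
  U 1 / U 0 - Real.sqrt ((U 0 + s) / U 0 * (((U 0 + s) ^ γ - (U 0) ^ γ) / s))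

/-- Left state of the **2-shock** with right state `U = (ρ, ρu)` and density jump `s`:
`S²_U(s) = (ρ + s, (ρ + s)(u + √((P(ρ+s) - P(ρ)) s / (ρ(ρ+s)))))`
(Leger–Vasseur §6.1, (H'1) case). [cite: LegerVasseur2011, §6.1] -/
def twoShockCurve (γ : ℝ) (U : Fin 2 → ℝ) (s : ℝ) : Fin 2 → ℝ :=
  ![U 0 + s, (U 0 + s) * (U 1 / U 0
    + Real.sqrt (((U 0 + s) ^ γ - (U 0) ^ γ) * s / (U 0 * (U 0 + s))))]

/-- Speed of the 2-shock with right state `U = (ρ, ρu)` and density jump `s`: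
`σ²_U(s) = u + √(((ρ+s)/ρ) (P(ρ+s) - P(ρ))/s)`. [cite: LegerVasseur2011, §6.1] -/
def twoShockSpeed (γ : ℝ) (U : Fin 2 → ℝ) (s : ℝ) : ℝ :=
  U 1 / U 0 + Real.sqrt ((U 0 + s) / U 0 * (((U 0 + s) ^ γ - (U 0) ^ γ) / s))

/-! ### Unfolding -/

/-- Density behind the 1-shock: `ρ + s`. [cite: LegerVasseur2011, §6.1] -/
@[simp] theorem oneShockCurve_zero_apply (γ : ℝ) (U : Fin 2 → ℝ) (s : ℝ) :
    oneShockCurve γ U s 0 = U 0 + s := rfl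

/-- Momentum behind the 1-shock. [cite: LegerVasseur2011, §6.1] -/
theorem oneShockCurve_one_apply (γ : ℝ) (U : Fin 2 → ℝ) (s : ℝ) :
    oneShockCurve γ U s 1 = (U 0 + s) * (U 1 / U 0
      - Real.sqrt (((U 0 + s) ^ γ - (U 0) ^ γ) * s / (U 0 * (U 0 + s)))) := rfl

/-- Density ahead (left) of the 2-shock: `ρ + s`. [cite: LegerVasseur2011, §6.1] -/
@[simp] theorem twoShockCurve_zero_apply (γ : ℝ) (U : Fin 2 → ℝ) (s : ℝ) :
    twoShockCurve γ U s 0 = U 0 + s := rfl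

/-- Momentum of the left state of the 2-shock. [cite: LegerVasseur2011, §6.1] -/
theorem twoShockCurve_one_apply (γ : ℝ) (U : Fin 2 → ℝ) (s : ℝ) :
    twoShockCurve γ U s 1 = (U 0 + s) * (U 1 / U 0
      + Real.sqrt (((U 0 + s) ^ γ - (U 0) ^ γ) * s / (U 0 * (U 0 + s)))) := rfl

/-- `S¹_U(0) = U` for `ρ ≠ 0`. [cite: LegerVasseur2011, §2.2 (H1)] -/
theorem oneShockCurve_zero (γ : ℝ) {U : Fin 2 → ℝ} (hρ : U 0 ≠ 0) : oneShockCurve γ U 0 = U := by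
  ext i
  fin_cases i
  · simp
  · simp [oneShockCurve_one_apply, mul_div_cancel₀ _ hρ]

/-- `S²_U(0) = U` for `ρ ≠ 0`. [cite: LegerVasseur2011, §2.2 (H'1)] -/
theorem twoShockCurve_zero (γ : ℝ) {U : Fin 2 → ℝ} (hρ : U 0 ≠ 0) : twoShockCurve γ U 0 = U := by
  ext i
  fin_cases i
  · simp
  · simp [twoShockCurve_one_apply, mul_div_cancel₀ _ hρ]

/-! ### Signs: the pressure jump and the radicands -/

/-- The pressure jump `P(ρ+s) - P(ρ) > 0` for `ρ > 0`, `s > 0`, `γ > 0`. [folklore] -/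
theorem pressureJump_pos (hγ : 0 < γ) {ρ s : ℝ} (hρ : 0 < ρ) (hs : 0 < s) :
    0 < (ρ + s) ^ γ - ρ ^ γ :=
  sub_pos.2 (Real.rpow_lt_rpow hρ.le (by linarith) hγ)

/-- The radicand of the velocity jump is positive. [folklore] -/
theorem velJumpRadicand_pos (hγ : 0 < γ) {ρ s : ℝ} (hρ : 0 < ρ) (hs : 0 < s) :
    0 < ((ρ + s) ^ γ - ρ ^ γ) * s / (ρ * (ρ + s)) := by
  have := pressureJump_pos hγ hρ hs
  have hρs : 0 < ρ + s := by linarith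
  positivity

/-- The radicand of the speed is positive. [folklore] -/
theorem speedRadicand_pos (hγ : 0 < γ) {ρ s : ℝ} (hρ : 0 < ρ) (hs : 0 < s) :
    0 < (ρ + s) / ρ * (((ρ + s) ^ γ - ρ ^ γ) / s) := by
  have := pressureJump_pos hγ hρ hs
  have hρs : 0 < ρ + s := by linarith
  positivity

/-- The key algebraic identity between the two square roots:
`s √(((ρ+s)/ρ)(P(ρ+s)-P(ρ))/s) = (ρ+s) √((P(ρ+s)-P(ρ)) s/(ρ(ρ+s)))` (both equal
`√(s(ρ+s)(P(ρ+s)-P(ρ))/ρ)`). [folklore] -/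
theorem mul_sqrt_speedRadicand_eq (hγ : 0 < γ) {ρ s : ℝ} (hρ : 0 < ρ) (hs : 0 < s) :
    s * Real.sqrt ((ρ + s) / ρ * (((ρ + s) ^ γ - ρ ^ γ) / s))
      = (ρ + s) * Real.sqrt (((ρ + s) ^ γ - ρ ^ γ) * s / (ρ * (ρ + s))) := by
  have hP := pressureJump_pos hγ hρ hs
  have hρs : 0 < ρ + s := by linarith
  have e1 : Real.sqrt (s ^ 2 * ((ρ + s) / ρ * (((ρ + s) ^ γ - ρ ^ γ) / s)))
      = s * Real.sqrt ((ρ + s) / ρ * (((ρ + s) ^ γ - ρ ^ γ) / s)) := by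
    rw [Real.sqrt_mul (sq_nonneg s), Real.sqrt_sq hs.le]
  have e2 : Real.sqrt ((ρ + s) ^ 2 * (((ρ + s) ^ γ - ρ ^ γ) * s / (ρ * (ρ + s))))
      = (ρ + s) * Real.sqrt (((ρ + s) ^ γ - ρ ^ γ) * s / (ρ * (ρ + s))) := by
    rw [Real.sqrt_mul (sq_nonneg (ρ + s)), Real.sqrt_sq hρs.le]
  rw [← e1, ← e2]
  congr 1
  field_simp

/-! ### The curves satisfy the Rankine–Hugoniot condition -/

/-- **`(U, S¹_U(s))` is a Rankine–Hugoniot discontinuity with speed `σ¹_U(s)`** for the isentropic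
Euler flux (`ρ > 0`, `s > 0`, `γ > 0`). [cite: LegerVasseur2011, §6.1 and §2.2 (H1)] -/
theorem isRankineHugoniot_oneShockCurve (hγ : 0 < γ) {U : Fin 2 → ℝ} (hρ : 0 < U 0) {s : ℝ}
    (hs : 0 < s) :
    IsRankineHugoniot (isentropicEulerFlux γ) U (oneShockCurve γ U s) (oneShockSpeed γ U s) := by
  rw [isRankineHugoniot_iff]
  have hP := pressureJump_pos hγ hρ hs
  have hρs : 0 < U 0 + s := by linarith
  have hρ' : U 0 ≠ 0 := hρ.ne'
  have hρs' : U 0 + s ≠ 0 := hρs.ne'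
  set A := Real.sqrt (((U 0 + s) ^ γ - (U 0) ^ γ) * s / (U 0 * (U 0 + s))) with hA
  set B := Real.sqrt ((U 0 + s) / U 0 * (((U 0 + s) ^ γ - (U 0) ^ γ) / s)) with hB
  set u := U 1 / U 0 with hu
  have hU1 : U 1 = U 0 * u := by rw [hu]; field_simp
  have hAB : s * B = (U 0 + s) * A := mul_sqrt_speedRadicand_eq hγ hρ hs
  have hA2 : U 0 * (U 0 + s) * A ^ 2 = ((U 0 + s) ^ γ - (U 0) ^ γ) * s := by
    rw [hA, Real.sq_sqrt (velJumpRadicand_pos hγ hρ hs).le]; field_simp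
  have hB2 : U 0 * s * B ^ 2 = (U 0 + s) * ((U 0 + s) ^ γ - (U 0) ^ γ) := by
    rw [hB, Real.sq_sqrt (speedRadicand_pos hγ hρ hs).le]; field_simp
  intro i
  fin_cases i
  · -- mass: `m_R - m_L = σ (ρ_R - ρ_L)`
    simp only [isentropicEulerFlux, oneShockCurve, oneShockSpeed, Fin.zero_eta, Fin.isValue,
      Matrix.cons_val_zero, Matrix.cons_val_one, Matrix.cons_val_fin_one, ← hA, ← hB, ← hu]
    rw [hU1]
    linear_combination hAB
  · -- momentum: `(m_R²/ρ_R + P_R) - (m_L²/ρ_L + P_L) = σ (m_R - m_L)`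
    simp only [isentropicEulerFlux, oneShockCurve, oneShockSpeed, Fin.mk_one, Fin.isValue,
      Matrix.cons_val_zero, Matrix.cons_val_one, Matrix.cons_val_fin_one, ← hA, ← hB, ← hu]
    rw [hU1]
    have e1 : ((U 0 + s) * (u - A)) ^ 2 / (U 0 + s) = (U 0 + s) * (u - A) ^ 2 := by
      field_simp
    have e0 : (U 0 * u) ^ 2 / U 0 = U 0 * u ^ 2 := by field_simp
    rw [e1, e0]
    apply mul_left_cancel₀ hρ'
    linear_combination (U 0 * u + U 0 * B) * hAB + hA2 - hB2

/-- **`(S²_U(s), U)` is a Rankine–Hugoniot discontinuity with speed `σ²_U(s)`** for the isentropic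
Euler flux (`ρ > 0`, `s > 0`, `γ > 0`). [cite: LegerVasseur2011, §6.1 and §2.2 (H'1)] -/
theorem isRankineHugoniot_twoShockCurve (hγ : 0 < γ) {U : Fin 2 → ℝ} (hρ : 0 < U 0) {s : ℝ}
    (hs : 0 < s) :
    IsRankineHugoniot (isentropicEulerFlux γ) (twoShockCurve γ U s) U (twoShockSpeed γ U s) := by
  rw [isRankineHugoniot_iff]
  have hP := pressureJump_pos hγ hρ hs
  have hρs : 0 < U 0 + s := by linarith
  have hρ' : U 0 ≠ 0 := hρ.ne'
  have hρs' : U 0 + s ≠ 0 := hρs.ne'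
  set A := Real.sqrt (((U 0 + s) ^ γ - (U 0) ^ γ) * s / (U 0 * (U 0 + s))) with hA
  set B := Real.sqrt ((U 0 + s) / U 0 * (((U 0 + s) ^ γ - (U 0) ^ γ) / s)) with hB
  set u := U 1 / U 0 with hu
  have hU1 : U 1 = U 0 * u := by rw [hu]; field_simp
  have hAB : s * B = (U 0 + s) * A := mul_sqrt_speedRadicand_eq hγ hρ hs
  have hA2 : U 0 * (U 0 + s) * A ^ 2 = ((U 0 + s) ^ γ - (U 0) ^ γ) * s := by
    rw [hA, Real.sq_sqrt (velJumpRadicand_pos hγ hρ hs).le]; field_simp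
  have hB2 : U 0 * s * B ^ 2 = (U 0 + s) * ((U 0 + s) ^ γ - (U 0) ^ γ) := by
    rw [hB, Real.sq_sqrt (speedRadicand_pos hγ hρ hs).le]; field_simp
  intro i
  fin_cases i
  · simp only [isentropicEulerFlux, twoShockCurve, twoShockSpeed, Fin.zero_eta, Fin.isValue,
      Matrix.cons_val_zero, Matrix.cons_val_one, Matrix.cons_val_fin_one, ← hA, ← hB, ← hu]
    rw [hU1]
    linear_combination hAB
  · simp only [isentropicEulerFlux, twoShockCurve, twoShockSpeed, Fin.mk_one, Fin.isValue,
      Matrix.cons_val_zero, Matrix.cons_val_one, Matrix.cons_val_fin_one, ← hA, ← hB, ← hu]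
    rw [hU1]
    have e1 : ((U 0 + s) * (u + A)) ^ 2 / (U 0 + s) = (U 0 + s) * (u + A) ^ 2 := by
      field_simp
    have e0 : (U 0 * u) ^ 2 / U 0 = U 0 * u ^ 2 := by field_simp
    rw [e1, e0]
    apply mul_left_cancel₀ hρ'
    linear_combination (U 0 * u - U 0 * B) * hAB - hA2 + hB2

/-! ### Both shocks are compressive -/

/-- Across the 1-shock the density increases: `ρ_R = ρ_L + s > ρ_L`. [cite: LegerVasseur2011, §6.1] -/
theorem density_lt_oneShockCurve (γ : ℝ) (U : Fin 2 → ℝ) {s : ℝ} (hs : 0 < s) :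
    U 0 < oneShockCurve γ U s 0 := by
  simp [hs]

/-- Across the 1-shock the velocity decreases: `u_R = u_L - √(…) < u_L` ("entropy admissible shocks
are characterized by the relation `u_L > u_R`"). [cite: LegerVasseur2011, §6.1] -/
theorem vel_oneShockCurve_lt (hγ : 0 < γ) {U : Fin 2 → ℝ} (hρ : 0 < U 0) {s : ℝ} (hs : 0 < s) :
    oneShockCurve γ U s 1 / oneShockCurve γ U s 0 < U 1 / U 0 := by
  have hρs : 0 < U 0 + s := by linarith
  rw [oneShockCurve_one_apply, oneShockCurve_zero_apply, mul_div_cancel_left₀ _ hρs.ne']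
  have : 0 < Real.sqrt (((U 0 + s) ^ γ - U 0 ^ γ) * s / (U 0 * (U 0 + s))) :=
    Real.sqrt_pos.2 (velJumpRadicand_pos hγ hρ hs)
  linarith

/-- Across the 2-shock the density decreases from left to right: `ρ_L = ρ_R + s > ρ_R`.
[cite: LegerVasseur2011, §6.1] -/
theorem density_lt_twoShockCurve (γ : ℝ) (U : Fin 2 → ℝ) {s : ℝ} (hs : 0 < s) :
    U 0 < twoShockCurve γ U s 0 := by
  simp [hs]

/-- Across the 2-shock the velocity decreases from left to right: `u_L = u_R + √(…) > u_R`.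
[cite: LegerVasseur2011, §6.1] -/
theorem vel_lt_twoShockCurve (hγ : 0 < γ) {U : Fin 2 → ℝ} (hρ : 0 < U 0) {s : ℝ} (hs : 0 < s) :
    U 1 / U 0 < twoShockCurve γ U s 1 / twoShockCurve γ U s 0 := by
  have hρs : 0 < U 0 + s := by linarith
  rw [twoShockCurve_one_apply, twoShockCurve_zero_apply, mul_div_cancel_left₀ _ hρs.ne']
  have : 0 < Real.sqrt (((U 0 + s) ^ γ - U 0 ^ γ) * s / (U 0 * (U 0 + s))) :=
    Real.sqrt_pos.2 (velJumpRadicand_pos hγ hρ hs)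
  linarith

/-! ### Lax inequalities along the shock curves (convexity of `P(ρ) = ρ^γ`, `γ ≥ 1`) -/

/-- Chord above the left tangent: `P′(ρ) ≤ (P(ρ+s) - P(ρ))/s` for the convex `P(ρ) = ρ^γ`,
`γ ≥ 1`. [folklore] -/
theorem deriv_le_pressureSlope (hγ : 1 ≤ γ) {ρ s : ℝ} (hρ : 0 < ρ) (hs : 0 < s) :
    γ * ρ ^ (γ - 1) ≤ ((ρ + s) ^ γ - ρ ^ γ) / s := by
  have h := (convexOn_rpow hγ).le_slope_of_hasDerivAt (Set.mem_Ici.2 hρ.le)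
    (Set.mem_Ici.2 (by linarith : (0 : ℝ) ≤ ρ + s)) (by linarith)
    (Real.hasDerivAt_rpow_const (p := γ) (Or.inl hρ.ne'))
  rw [slope_def_field] at h
  simpa using h

/-- Chord below the right tangent: `(P(ρ+s) - P(ρ))/s ≤ P′(ρ+s)` for the convex `P(ρ) = ρ^γ`,
`γ ≥ 1`. [folklore] -/
theorem pressureSlope_le_deriv (hγ : 1 ≤ γ) {ρ s : ℝ} (hρ : 0 < ρ) (hs : 0 < s) :
    ((ρ + s) ^ γ - ρ ^ γ) / s ≤ γ * (ρ + s) ^ (γ - 1) := by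
  have hρs : 0 < ρ + s := by linarith
  have h := (convexOn_rpow hγ).slope_le_of_hasDerivAt (Set.mem_Ici.2 hρ.le)
    (Set.mem_Ici.2 hρs.le) (by linarith)
    (Real.hasDerivAt_rpow_const (p := γ) (Or.inl hρs.ne'))
  rw [slope_def_field] at h
  simpa using h

/-- The sound speed at the low-density side is below the shock speed defect:
`√γ ρ^{(γ-1)/2} < √(((ρ+s)/ρ)(P(ρ+s)-P(ρ))/s)` (`(√γρ^{(γ-1)/2})² = P′(ρ) ≤ slope < ((ρ+s)/ρ)·slope`).
[cite: LegerVasseur2011, §6.1 ("the Lax admissibility conditions also hold globally")] -/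
theorem soundSpeed_lt_sqrt_speedRadicand (hγ : 1 ≤ γ) {ρ s : ℝ} (hρ : 0 < ρ) (hs : 0 < s) :
    Real.sqrt γ * ρ ^ ((γ - 1) / 2) < Real.sqrt ((ρ + s) / ρ * (((ρ + s) ^ γ - ρ ^ γ) / s)) := by
  have hγ0 : 0 < γ := by linarith
  have hc0 : 0 ≤ Real.sqrt γ * ρ ^ ((γ - 1) / 2) := by positivity
  rw [Real.lt_sqrt hc0, sq_soundSpeed hγ0.le hρ]
  have hslope : 0 < ((ρ + s) ^ γ - ρ ^ γ) / s := div_pos (pressureJump_pos hγ0 hρ hs) hs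
  have hratio : 1 < (ρ + s) / ρ := by rw [lt_div_iff₀ hρ]; linarith
  calc γ * ρ ^ (γ - 1) ≤ ((ρ + s) ^ γ - ρ ^ γ) / s := deriv_le_pressureSlope hγ hρ hs
    _ < (ρ + s) / ρ * (((ρ + s) ^ γ - ρ ^ γ) / s) := lt_mul_of_one_lt_left hslope hratio

/-- The velocity defect at the high-density side is below the sound speed there:
`(ρ/s)√((P(ρ+s)-P(ρ))s/(ρ(ρ+s))) < √γ (ρ+s)^{(γ-1)/2}` (its square is `(ρ/(ρ+s))·slope ≤ slope ≤ P′(ρ+s)`).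
[cite: LegerVasseur2011, §6.1 ("the Lax admissibility conditions also hold globally")] -/
theorem velDefect_lt_soundSpeed (hγ : 1 ≤ γ) {ρ s : ℝ} (hρ : 0 < ρ) (hs : 0 < s) :
    ρ / s * Real.sqrt (((ρ + s) ^ γ - ρ ^ γ) * s / (ρ * (ρ + s)))
      < Real.sqrt γ * (ρ + s) ^ ((γ - 1) / 2) := by
  have hγ0 : 0 < γ := by linarith
  have hρs : 0 < ρ + s := by linarith
  have hP := pressureJump_pos hγ0 hρ hs
  have hcR : Real.sqrt γ * (ρ + s) ^ ((γ - 1) / 2) = Real.sqrt (γ * (ρ + s) ^ (γ - 1)) := by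
    rw [← sq_soundSpeed hγ0.le hρs, Real.sqrt_sq (by positivity)]
  rw [hcR, Real.lt_sqrt (by positivity), mul_pow,
    Real.sq_sqrt (velJumpRadicand_pos hγ0 hρ hs).le]
  have hslope : 0 < ((ρ + s) ^ γ - ρ ^ γ) / s := div_pos hP hs
  have e : (ρ / s) ^ 2 * (((ρ + s) ^ γ - ρ ^ γ) * s / (ρ * (ρ + s)))
      = ρ / (ρ + s) * (((ρ + s) ^ γ - ρ ^ γ) / s) := by
    field_simp
  rw [e]
  have hratio : ρ / (ρ + s) < 1 := (div_lt_one hρs).2 (by linarith)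
  calc ρ / (ρ + s) * (((ρ + s) ^ γ - ρ ^ γ) / s) < ((ρ + s) ^ γ - ρ ^ γ) / s :=
        mul_lt_of_lt_one_left hslope hratio
    _ ≤ γ * (ρ + s) ^ (γ - 1) := pressureSlope_le_deriv hγ hρ hs

/-- **Lax condition for the 1-shock, left side** (Chen–Krupa–Vasseur Assumption 1.1 (h) context /
Leger–Vasseur (H1a) at `s`): `σ¹_U(s) < λ₁(U) = u - √γ ρ^{(γ-1)/2}` for `s > 0`.
[cite: LegerVasseur2011, §6.1] -/
theorem oneShockSpeed_lt_charSpeed_left (hγ : 1 ≤ γ) {U : Fin 2 → ℝ} (hρ : 0 < U 0) {s : ℝ}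
    (hs : 0 < s) :
    oneShockSpeed γ U s < U 1 / U 0 - Real.sqrt γ * (U 0) ^ ((γ - 1) / 2) := by
  have := soundSpeed_lt_sqrt_speedRadicand hγ hρ hs
  unfold oneShockSpeed
  linarith

/-- **Lax condition for the 1-shock, right side** (Chen–Krupa–Vasseur Assumption 1.1 (g) along
`S¹`): `λ₁(S¹_U(s)) < σ¹_U(s)` for `s > 0`. [cite: LegerVasseur2011, §6.1] -/
theorem charSpeed_right_lt_oneShockSpeed (hγ : 1 ≤ γ) {U : Fin 2 → ℝ} (hρ : 0 < U 0) {s : ℝ}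
    (hs : 0 < s) :
    oneShockCurve γ U s 1 / oneShockCurve γ U s 0
        - Real.sqrt γ * (oneShockCurve γ U s 0) ^ ((γ - 1) / 2) < oneShockSpeed γ U s := by
  have hγ0 : 0 < γ := by linarith
  have hρs : 0 < U 0 + s := by linarith
  have hAB := mul_sqrt_speedRadicand_eq hγ0 hρ hs
  have hdef := velDefect_lt_soundSpeed hγ hρ hs
  rw [oneShockCurve_one_apply, oneShockCurve_zero_apply, mul_div_cancel_left₀ _ hρs.ne']
  unfold oneShockSpeed
  set A := Real.sqrt (((U 0 + s) ^ γ - (U 0) ^ γ) * s / (U 0 * (U 0 + s))) with hA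
  set B := Real.sqrt ((U 0 + s) / U 0 * (((U 0 + s) ^ γ - (U 0) ^ γ) / s)) with hB
  have hBA : B - A = U 0 / s * A := by
    field_simp
    linear_combination hAB
  linarith

/-- **Lax condition for the 2-shock, right side** (Chen–Krupa–Vasseur Assumption 1.1 (j) context /
Leger–Vasseur (H'1a) at `s`): `λ₂(U) = u + √γ ρ^{(γ-1)/2} < σ²_U(s)` for `s > 0`.
[cite: LegerVasseur2011, §6.1] -/
theorem charSpeed_right_lt_twoShockSpeed (hγ : 1 ≤ γ) {U : Fin 2 → ℝ} (hρ : 0 < U 0) {s : ℝ}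
    (hs : 0 < s) :
    U 1 / U 0 + Real.sqrt γ * (U 0) ^ ((γ - 1) / 2) < twoShockSpeed γ U s := by
  have := soundSpeed_lt_sqrt_speedRadicand hγ hρ hs
  unfold twoShockSpeed
  linarith

/-- **Lax condition for the 2-shock, left side** (Chen–Krupa–Vasseur Assumption 1.1 (i) along
`S²`): `σ²_U(s) < λ₂(S²_U(s))` for `s > 0`. [cite: LegerVasseur2011, §6.1] -/
theorem twoShockSpeed_lt_charSpeed_left (hγ : 1 ≤ γ) {U : Fin 2 → ℝ} (hρ : 0 < U 0) {s : ℝ}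
    (hs : 0 < s) :
    twoShockSpeed γ U s < twoShockCurve γ U s 1 / twoShockCurve γ U s 0
        + Real.sqrt γ * (twoShockCurve γ U s 0) ^ ((γ - 1) / 2) := by
  have hγ0 : 0 < γ := by linarith
  have hρs : 0 < U 0 + s := by linarith
  have hAB := mul_sqrt_speedRadicand_eq hγ0 hρ hs
  have hdef := velDefect_lt_soundSpeed hγ hρ hs
  rw [twoShockCurve_one_apply, twoShockCurve_zero_apply, mul_div_cancel_left₀ _ hρs.ne']
  unfold twoShockSpeed
  set A := Real.sqrt (((U 0 + s) ^ γ - (U 0) ^ γ) * s / (U 0 * (U 0 + s))) with hA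
  set B := Real.sqrt ((U 0 + s) / U 0 * (((U 0 + s) ^ γ - (U 0) ^ γ) / s)) with hB
  have hBA : B - A = U 0 / s * A := by
    field_simp
    linear_combination hAB
  linarith

end Literature.Analysis.PDE
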